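import Summits.BirchSwinnertonDyer.BirchSwinnertonDyer.Theorems.PrintCf2RubinValueTwoLinePinPowFormAwayDefects
import HarnessLib

/-!
# M-LINE-PIN, (Q)-SOCKET-RAT IV: the calculus of characteristic ideals UP TO POWERS OF `(ϖ)` —
# `char M · (ϖ)^i = char N · (ϖ)^j` is an equivalence relation stable under products, and is produced by linear maps whose
# kernel and cokernel vanish at every height-`≤ 1` prime away from `ϖ`

Cell `bsd-print-cf2`, width seat `bsd-line-cf2c-w8` g5 (prover-bsd-line-cf2c-w8-g5-0), lane M-LINE-PIN / (Q)-SOCKET-RAT of the DECIDING research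
child of `PrintCf2RubinValueTwo.TwoVariableMainConjAtSplitTwoQuadDA` (stmt-BirchSwinnertonDyer-24245). `--supports stmt-BirchSwinnertonDyer-24245 --as helper`,
Theses-free. Part IV of (Q)-SOCKET-RAT (I p709488, II p709861, III p710835). HONEST FRAMING: generic commutative algebra for the assemblers of the
bricks (a) (class-group half ⊗ℚ), (c) (Coleman half for the `χ`-COINVARIANTS `U_χ`, whose passage from `U` costs `#Υ`-killed defects) and (e2)
(comparison maps with finite defects): every step of their bookkeeping is an identity of characteristic ideals UP TO A POWER OF `(p)`, and this file
makes that relation composable. Nothing here proves a brick; no summit statement is proved by this seat; BSD is not proved by any of this.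

THE RELATION. For ideals `I, J` of a commutative ring and an ideal `P` (here `P = (ϖ)`): `I ≐ J :⟺ ∃ i j, I·P^i = J·P^j` — written OUT in every
statement (no definition is introduced). §1: `≐` is reflexive, symmetric, transitive, multiplicative, contains `=`, absorbs powers of `P`.
§2 (Noetherian domain `R`, prime element `ϖ`, «away-null» = `M_𝔭 = 0` pointwise at every prime `𝔭` of height `≤ 1` with `ϖ ∉ 𝔭`, part II
`FourTerm.charIdeal_eq_span_singleton_pow_of_forall_away`): **producers** — `exists_charIdeal_mul_pow_eq_one_of_forall_away` (away-null ⟹ `char ≐ 1`),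
`exists_charIdeal_mul_pow_eq_of_injective_of_away` (`f : M ↪ N`, cokernel away-null ⟹ `char M ≐ char N`), `…_of_surjective_of_away` (`f : M ↠ N`,
kernel away-null), **`exists_charIdeal_mul_pow_eq_of_away_ker_coker`** (both — the ⊗ℚ analogue of «pseudo-isomorphic modules have the same
characteristic ideal», tree `charIdeal_eq_of_arePseudoIsomorphic`), and `exists_charIdeal_mul_pow_eq_of_exact_of_away` (short exact `0 → A → B → C → 0`
with `A` away-null ⟹ `char B ≐ char C`; with `C` away-null ⟹ `char B ≐ char A`).
THEOREMS ONLY (no `def`, no named fact, no `sorry`). presearch: NSW V §1 (5.1.4)–(5.1.6), §3 (5.3.9)–(5.3.10) [corpus]; folklore. beyond-print theorem: no.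

References: Neukirch–Schmidt–Wingberg, Ch. V §1 (5.1.4)–(5.1.6), §3 (5.3.9)–(5.3.10) [NeukirchSchmidtWingberg2008]; N. Bourbaki, *Algèbre commutative*
VII §4.4–4.5; K. Rubin, Invent. Math. 103 (1991) §4 Remark (2) [Rubin1991].
-/

noncomputable section

set_option linter.dupNamespace false -- D-0017: single-problem summit, `…BirchSwinnertonDyer.BirchSwinnertonDyer…` repeats a namespace by design
set_option autoImplicit false

open scoped Classical

namespace Summit.BirchSwinnertonDyer.BirchSwinnertonDyer.Theorems.PrintCf2.FourTerm

open Literature.NumberTheory.EllipticCurves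

universe u₁ u₂ u₃

/-! ## §1. `I·P^i = J·P^j` as a relation: equivalence, products, absorption -/

section Relation

variable {R : Type*} [CommSemiring R] (P : Ideal R)

/-- Reflexivity: `I ≐ I`. [folklore] -/
theorem exists_mul_pow_eq_refl (I : Ideal R) : ∃ i j : ℕ, I * P ^ i = I * P ^ j := ⟨0, 0, rfl⟩

/-- `=` implies `≐`. [folklore] -/
theorem exists_mul_pow_eq_of_eq {I J : Ideal R} (h : I = J) : ∃ i j : ℕ, I * P ^ i = J * P ^ j := ⟨0, 0, by rw [h]⟩

/-- Symmetry. [folklore] -/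
theorem exists_mul_pow_eq_symm {I J : Ideal R} (h : ∃ i j : ℕ, I * P ^ i = J * P ^ j) : ∃ i j : ℕ, J * P ^ i = I * P ^ j := by
  obtain ⟨i, j, h⟩ := h
  exact ⟨j, i, h.symm⟩

/-- Transitivity: `I·P^i = J·P^j`, `J·P^k = K·P^l` ⟹ `I·P^{i+k} = K·P^{l+j}`. [folklore] -/
theorem exists_mul_pow_eq_trans {I J K : Ideal R} (h₁ : ∃ i j : ℕ, I * P ^ i = J * P ^ j) (h₂ : ∃ i j : ℕ, J * P ^ i = K * P ^ j) :
    ∃ i j : ℕ, I * P ^ i = K * P ^ j := by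
  obtain ⟨i, j, h₁⟩ := h₁
  obtain ⟨k, l, h₂⟩ := h₂
  refine ⟨i + k, l + j, ?_⟩
  calc I * P ^ (i + k) = I * P ^ i * P ^ k := by rw [pow_add, mul_assoc]
    _ = J * P ^ k * P ^ j := by rw [h₁]; ring
    _ = K * P ^ (l + j) := by rw [h₂, pow_add, mul_assoc]

/-- Multiplicativity: `I ≐ J`, `I′ ≐ J′` ⟹ `I·I′ ≐ J·J′`. [folklore] -/
theorem exists_mul_pow_eq_mul {I J I' J' : Ideal R} (h₁ : ∃ i j : ℕ, I * P ^ i = J * P ^ j) (h₂ : ∃ i j : ℕ, I' * P ^ i = J' * P ^ j) :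
    ∃ i j : ℕ, I * I' * P ^ i = J * J' * P ^ j := by
  obtain ⟨i, j, h₁⟩ := h₁
  obtain ⟨k, l, h₂⟩ := h₂
  refine ⟨i + k, j + l, ?_⟩
  calc I * I' * P ^ (i + k) = (I * P ^ i) * (I' * P ^ k) := by rw [pow_add]; ring
    _ = (J * P ^ j) * (J' * P ^ l) := by rw [h₁, h₂]
    _ = J * J' * P ^ (j + l) := by rw [pow_add]; ring

/-- Absorption of powers of `P` on the left: `I·P^n ≐ I`. [folklore] -/
theorem exists_mul_pow_eq_mul_pow_self (I : Ideal R) (n : ℕ) : ∃ i j : ℕ, I * P ^ n * P ^ i = I * P ^ j := ⟨0, n, by rw [pow_zero, mul_one]⟩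

/-- A power of `P` is `≐ 1`. [folklore] -/
theorem exists_pow_mul_pow_eq_one (n : ℕ) : ∃ i j : ℕ, P ^ n * P ^ i = 1 * P ^ j := ⟨0, n, by rw [pow_zero, mul_one, one_mul]⟩

/-- Cancellation of a common left factor that is `≐ 1`: `I ≐ 1`, `I·J ≐ K` ⟹ `J ≐ K`. [folklore] -/
theorem exists_mul_pow_eq_of_mul_left {I J K : Ideal R} (hI : ∃ i j : ℕ, I * P ^ i = 1 * P ^ j) (h : ∃ i j : ℕ, I * J * P ^ i = K * P ^ j) :
    ∃ i j : ℕ, J * P ^ i = K * P ^ j := by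
  obtain ⟨i, j, hI⟩ := hI
  obtain ⟨k, l, h⟩ := h
  -- `J·P^{j+k} = (I·P^i)·J·P^k = K·P^l·P^i`
  refine ⟨j + k, l + i, ?_⟩
  calc J * P ^ (j + k) = (1 * P ^ j) * J * P ^ k := by rw [pow_add]; ring
    _ = (I * P ^ i) * J * P ^ k := by rw [hI]
    _ = I * J * P ^ k * P ^ i := by ring
    _ = K * P ^ (l + i) := by rw [h, pow_add, mul_assoc]

end Relation

/-! ## §2. Producers over a Noetherian domain: away-from-`ϖ`-null kernels and cokernels -/

section Producers

variable {R : Type*} [CommRing R] [IsNoetherianRing R] [IsDomain R] {ϖ : R}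
  {M : Type u₁} [AddCommGroup M] [Module R M] {N : Type u₂} [AddCommGroup N] [Module R N]
  {L : Type u₃} [AddCommGroup L] [Module R L]

/-- **Away-null ⟹ `char ≐ 1`.** [cite: NeukirchSchmidtWingberg2008, Ch. V §3, (5.3.9)–(5.3.10)] -/
theorem exists_charIdeal_mul_pow_eq_one_of_forall_away (hϖ : Prime ϖ)
    (hM : ∀ 𝔭 : PrimeSpectrum R, 𝔭.asIdeal.height ≤ 1 → ϖ ∉ 𝔭.asIdeal → ∀ m : M, ∃ r ∉ 𝔭.asIdeal, r • m = 0) :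
    ∃ i j : ℕ, Module.charIdeal R M * Ideal.span {ϖ} ^ i = 1 * Ideal.span {ϖ} ^ j := by
  obtain ⟨k, hk⟩ := exists_charIdeal_eq_span_singleton_pow_of_forall_away hϖ hM
  exact ⟨0, k, by rw [hk, pow_zero, mul_one, one_mul]⟩

/-- **An injective map with away-null cokernel preserves `char` up to a power of `(ϖ)`**: `f : M ↪ N`, `N` finitely generated torsion, and for every
prime `𝔭` of height `≤ 1` with `ϖ ∉ 𝔭` every `n : N` has `r • n ∈ range f` for some `r ∉ 𝔭` ⟹ `∃ i j, char M·(ϖ)^i = char N·(ϖ)^j`.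
[cite: NeukirchSchmidtWingberg2008, Ch. V §1, (5.1.4)–(5.1.6); §3, (5.3.9)–(5.3.10)] -/
theorem exists_charIdeal_mul_pow_eq_of_injective_of_away (hϖ : Prime ϖ) [Module.Finite R N] (hN : Module.IsTorsion R N)
    (f : M →ₗ[R] N) (hf : Function.Injective f)
    (hcoker : ∀ 𝔭 : PrimeSpectrum R, 𝔭.asIdeal.height ≤ 1 → ϖ ∉ 𝔭.asIdeal → ∀ n : N, ∃ r ∉ 𝔭.asIdeal, r • n ∈ LinearMap.range f) :
    ∃ i j : ℕ, Module.charIdeal R M * Ideal.span {ϖ} ^ i = Module.charIdeal R N * Ideal.span {ϖ} ^ j := by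
  -- `char N = char(range f) · char(N / range f)`, `range f ≅ M`, `N / range f` away-null
  have hsplit := charIdeal_eq_mul_quotient hN (LinearMap.range f)
  have hM : Module.charIdeal R (LinearMap.range f) = Module.charIdeal R M :=
    (Module.charIdeal_eq_of_linearEquiv (LinearEquiv.ofInjective f hf)).symm
  obtain ⟨k, hk⟩ := exists_charIdeal_eq_span_singleton_pow_of_forall_away hϖ (M := N ⧸ LinearMap.range f)
    fun 𝔭 h𝔭 hϖ𝔭 q ↦ by
      obtain ⟨n, rfl⟩ := Submodule.mkQ_surjective _ q
      obtain ⟨r, hr, hrn⟩ := hcoker 𝔭 h𝔭 hϖ𝔭 n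
      refine ⟨r, hr, ?_⟩
      rw [Submodule.mkQ_apply, ← Submodule.Quotient.mk_smul, Submodule.Quotient.mk_eq_zero]
      exact hrn
  refine ⟨k, 0, ?_⟩
  rw [pow_zero, mul_one, hsplit, hM, hk]

/-- **A surjective map with away-null kernel preserves `char` up to a power of `(ϖ)`**: `f : M ↠ N`, `M` finitely generated torsion, `ker f`
away-null (pointwise) ⟹ `∃ i j, char M·(ϖ)^i = char N·(ϖ)^j`. [cite: NeukirchSchmidtWingberg2008, Ch. V §1, (5.1.4)–(5.1.6); §3, (5.3.9)–(5.3.10)] -/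
theorem exists_charIdeal_mul_pow_eq_of_surjective_of_away (hϖ : Prime ϖ) [Module.Finite R M] (hM : Module.IsTorsion R M)
    (f : M →ₗ[R] N) (hf : Function.Surjective f)
    (hker : ∀ 𝔭 : PrimeSpectrum R, 𝔭.asIdeal.height ≤ 1 → ϖ ∉ 𝔭.asIdeal → ∀ m : M, f m = 0 → ∃ r ∉ 𝔭.asIdeal, r • m = 0) :
    ∃ i j : ℕ, Module.charIdeal R M * Ideal.span {ϖ} ^ i = Module.charIdeal R N * Ideal.span {ϖ} ^ j := by
  -- `char M = char(ker f) · char(M / ker f)`, `M / ker f ≅ N`, `ker f` away-null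
  have hsplit := charIdeal_eq_mul_quotient hM (LinearMap.ker f)
  have hN : Module.charIdeal R (M ⧸ LinearMap.ker f) = Module.charIdeal R N :=
    Module.charIdeal_eq_of_linearEquiv (f.quotKerEquivOfSurjective hf)
  obtain ⟨k, hk⟩ := exists_charIdeal_eq_span_singleton_pow_of_forall_away hϖ (M := LinearMap.ker f)
    fun 𝔭 h𝔭 hϖ𝔭 m ↦ by
      obtain ⟨r, hr, hrm⟩ := hker 𝔭 h𝔭 hϖ𝔭 (m : M) (LinearMap.mem_ker.mp m.2)
      exact ⟨r, hr, Subtype.ext (by simpa using hrm)⟩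
  refine ⟨0, k, ?_⟩
  rw [pow_zero, mul_one, hsplit, hN, hk, mul_comm]

/-- **Away-null kernel AND cokernel ⟹ `char M ≐ char N`** — the ⊗ℚ analogue of «pseudo-isomorphic finitely generated torsion modules have the same
characteristic ideal» (tree: `charIdeal_eq_of_arePseudoIsomorphic`): `f : M → N` between finitely generated torsion modules over a Noetherian domain
whose kernel and cokernel vanish at every height-`≤ 1` prime not containing the prime element `ϖ` ⟹ `∃ i j, char M·(ϖ)^i = char N·(ϖ)^j`.
[cite: NeukirchSchmidtWingberg2008, Ch. V §1, (5.1.4)–(5.1.6); §3, (5.3.9)–(5.3.10)] -/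
theorem exists_charIdeal_mul_pow_eq_of_away_ker_coker (hϖ : Prime ϖ) [Module.Finite R M] (hM : Module.IsTorsion R M)
    [Module.Finite R N] (hN : Module.IsTorsion R N) (f : M →ₗ[R] N)
    (hker : ∀ 𝔭 : PrimeSpectrum R, 𝔭.asIdeal.height ≤ 1 → ϖ ∉ 𝔭.asIdeal → ∀ m : M, f m = 0 → ∃ r ∉ 𝔭.asIdeal, r • m = 0)
    (hcoker : ∀ 𝔭 : PrimeSpectrum R, 𝔭.asIdeal.height ≤ 1 → ϖ ∉ 𝔭.asIdeal → ∀ n : N, ∃ r ∉ 𝔭.asIdeal, r • n ∈ LinearMap.range f) :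
    ∃ i j : ℕ, Module.charIdeal R M * Ideal.span {ϖ} ^ i = Module.charIdeal R N * Ideal.span {ϖ} ^ j := by
  -- `M ↠ range f ↪ N`
  have h₁ := exists_charIdeal_mul_pow_eq_of_surjective_of_away hϖ hM f.rangeRestrict (LinearMap.surjective_rangeRestrict f)
    fun 𝔭 h𝔭 hϖ𝔭 m hm ↦ hker 𝔭 h𝔭 hϖ𝔭 m (by simpa using congrArg Subtype.val hm)
  have h₂ := exists_charIdeal_mul_pow_eq_of_injective_of_away hϖ hN (LinearMap.range f).subtype (Submodule.injective_subtype _)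
    fun 𝔭 h𝔭 hϖ𝔭 n ↦ by
      obtain ⟨r, hr, hrn⟩ := hcoker 𝔭 h𝔭 hϖ𝔭 n
      exact ⟨r, hr, by rwa [Submodule.range_subtype]⟩
  exact exists_mul_pow_eq_trans (Ideal.span {ϖ}) h₁ h₂

/-- **Short exact `0 → A → B → C → 0` with `A` away-null ⟹ `char B ≐ char C`.** [cite: NeukirchSchmidtWingberg2008, Ch. V §3, (5.3.9)–(5.3.10)] -/
theorem exists_charIdeal_mul_pow_eq_of_exact_of_away_left (hϖ : Prime ϖ) [Module.Finite R N] (hN : Module.IsTorsion R N)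
    (f : M →ₗ[R] N) (g : N →ₗ[R] L) (hfg : Function.Exact f g) (hg : Function.Surjective g)
    (hA : ∀ 𝔭 : PrimeSpectrum R, 𝔭.asIdeal.height ≤ 1 → ϖ ∉ 𝔭.asIdeal → ∀ m : M, ∃ r ∉ 𝔭.asIdeal, r • m = 0) :
    ∃ i j : ℕ, Module.charIdeal R N * Ideal.span {ϖ} ^ i = Module.charIdeal R L * Ideal.span {ϖ} ^ j := by
  refine exists_charIdeal_mul_pow_eq_of_surjective_of_away hϖ hN g hg fun 𝔭 h𝔭 hϖ𝔭 n hn ↦ ?_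
  obtain ⟨m, rfl⟩ := (hfg n).mp hn
  obtain ⟨r, hr, hrm⟩ := hA 𝔭 h𝔭 hϖ𝔭 m
  exact ⟨r, hr, by rw [← map_smul, hrm, map_zero]⟩

/-- **Short exact `0 → A → B → C → 0` with `C` away-null ⟹ `char A ≐ char B`.** [cite: NeukirchSchmidtWingberg2008, Ch. V §3, (5.3.9)–(5.3.10)] -/
theorem exists_charIdeal_mul_pow_eq_of_exact_of_away_right (hϖ : Prime ϖ) [Module.Finite R N] (hN : Module.IsTorsion R N)
    (f : M →ₗ[R] N) (g : N →ₗ[R] L) (hf : Function.Injective f) (hfg : Function.Exact f g)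
    (hC : ∀ 𝔭 : PrimeSpectrum R, 𝔭.asIdeal.height ≤ 1 → ϖ ∉ 𝔭.asIdeal → ∀ c : L, ∃ r ∉ 𝔭.asIdeal, r • c = 0) :
    ∃ i j : ℕ, Module.charIdeal R M * Ideal.span {ϖ} ^ i = Module.charIdeal R N * Ideal.span {ϖ} ^ j := by
  refine exists_charIdeal_mul_pow_eq_of_injective_of_away hϖ hN f hf fun 𝔭 h𝔭 hϖ𝔭 n ↦ ?_
  obtain ⟨r, hr, hrc⟩ := hC 𝔭 h𝔭 hϖ𝔭 (g n)
  refine ⟨r, hr, (hfg (r • n)).mp ?_⟩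
  rw [map_smul, hrc]

omit [IsNoetherianRing R] [IsDomain R] in
/-- **Killed by `ϖ^a` ⟹ away-null**, module form (the most frequent producer: `#Υ`-killed coinvariant defects, `2`-power index defects).
[folklore] -/
theorem forall_away_of_forall_pow_smul_eq_zero {ϖ' : R} (a : ℕ) (h : ∀ m : M, ϖ' ^ a • m = 0) :
    ∀ 𝔭 : PrimeSpectrum R, 𝔭.asIdeal.height ≤ 1 → ϖ' ∉ 𝔭.asIdeal → ∀ m : M, ∃ r ∉ 𝔭.asIdeal, r • m = 0 :=
  fun 𝔭 _ hϖ m ↦ ⟨ϖ' ^ a, fun hmem ↦ hϖ (𝔭.isPrime.mem_of_pow_mem a hmem), h m⟩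

end Producers

end Summit.BirchSwinnertonDyer.BirchSwinnertonDyer.Theorems.PrintCf2.FourTerm

end
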